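import Mathlib
import HarnessLib

/-!
# Local cones of a planar polygon at a boundary point

(Line `janus-bands`, crux `ArrangementNormalForm`, stub `stub_separateTwoZero` — separation in a
good rational direction for PLANAR arrangement representations without fibres; part `Cone`.)

Elementary planar geometry of an open polygon `Om g = {w | ∀ j, 0 < gⱼ(w)}` near a point of its
closure (the origin): it coincides there with the cone of its ACTIVE constraints
(`exists_nhds_cone`); if two active constraints have `u`-coefficients of opposite signs then
`|u| ≤ C |λ|` on the polygon (`abs_fst_le`, registered as `separateTwoZero_cone`: the pole line
`λ = 0` is transversal); otherwise a band along `λ = 0` lies in the polygon (`exists_band_subset`: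
the pole line is an edge); and a good sector at the origin lies in the polygon
(`exists_sector_subset`).
-/

noncomputable section

open Set MeasureTheory Filter Topology
open scoped ENNReal

namespace Summit.KontsevichZagierPeriods.ArrangementNormalForm.JanusBands

namespace SepTwoZero

/-- An affine function on the plane: `(α, β, γ) ↦ (u, λ) ↦ α u + β λ + γ`. -/
def aff (t : ℝ × ℝ × ℝ) (w : ℝ × ℝ) : ℝ := t.1 * w.1 + t.2.1 * w.2 + t.2.2

/-- The open planar polygon `{w | ∀ j, 0 < gⱼ(w)}`. -/
def Om {J : ℕ} (g : Fin J → ℝ × ℝ × ℝ) : Set (ℝ × ℝ) := {w | ∀ j, 0 < aff (g j) w}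

/-- The value of an affine function at the origin is its constant term. -/
@[simp] theorem aff_zero (t : ℝ × ℝ × ℝ) : aff t 0 = t.2.2 := by simp [aff]

/-- Affine functions are continuous. -/
theorem continuous_aff (t : ℝ × ℝ × ℝ) : Continuous (aff t) := by unfold aff; fun_prop

/-- The open polygon is open. -/
theorem isOpen_Om {J : ℕ} (g : Fin J → ℝ × ℝ × ℝ) : IsOpen (Om g) := by
  have : Om g = ⋂ j, {w | 0 < aff (g j) w} := by ext w; simp [Om]
  rw [this]
  exact isOpen_iInter_of_finite fun j => isOpen_lt continuous_const (continuous_aff _)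

variable {J : ℕ} (g : Fin J → ℝ × ℝ × ℝ)

/-- **Local cone.** Near a point of the closed polygon (here the origin), the polygon coincides
with the cone of its active constraints. -/
theorem exists_nhds_cone (h0 : ∀ j, 0 ≤ aff (g j) 0) :
    ∃ ρ > 0, ∀ w : ℝ × ℝ, |w.1| < ρ → |w.2| < ρ →
      (∀ j, aff (g j) 0 = 0 → 0 < aff (g j) w) → w ∈ Om g := by
  have hev : ∀ᶠ w in 𝓝 (0 : ℝ × ℝ), ∀ j, 0 < aff (g j) 0 → 0 < aff (g j) w := by
    refine eventually_all.2 fun j => ?_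
    by_cases hj : 0 < aff (g j) 0
    · exact (((continuous_aff (g j)).tendsto 0).eventually_const_lt hj).mono fun w hw _ => hw
    · exact Eventually.of_forall fun w h => absurd h hj
  obtain ⟨ρ, hρ, hb⟩ := Metric.eventually_nhds_iff.1 hev
  refine ⟨ρ, hρ, fun w h1 h2 hact j => ?_⟩
  rcases (h0 j).lt_or_eq with hj | hj
  · refine hb ?_ j hj
    rw [Prod.dist_eq, Real.dist_eq, Real.dist_eq]
    simpa using max_lt h1 h2
  · exact hact j hj.symm

/-- **Transversal case.** If two active constraints have `u`-coefficients of opposite signs,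
then `|u| ≤ C |λ|` on the polygon. -/
theorem abs_fst_le (j j' : Fin J) (hj0 : aff (g j) 0 = 0) (hj : (g j).1 < 0)
    (hj'0 : aff (g j') 0 = 0) (hj' : 0 < (g j').1) :
    ∃ C, 0 ≤ C ∧ ∀ w ∈ Om g, |w.1| ≤ C * |w.2| := by
  refine ⟨max (|(g j).2.1| / |(g j).1|) (|(g j').2.1| / (g j').1), by positivity, fun w hw => ?_⟩
  have h1 := hw j
  have h2 := hw j'
  simp only [aff_zero] at hj0 hj'0
  simp only [aff, hj0, hj'0, add_zero] at h1 h2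
  have hb1 : (g j).2.1 * w.2 ≤ |(g j).2.1| * |w.2| := by
    rw [← abs_mul]; exact le_abs_self _
  have hb2 : (g j').2.1 * w.2 ≤ |(g j').2.1| * |w.2| := by
    rw [← abs_mul]; exact le_abs_self _
  rcases le_or_gt 0 w.1 with hu | hu
  · rw [abs_of_nonneg hu]
    have hα : 0 < |(g j).1| := abs_pos.2 hj.ne
    have h3 : |(g j).1| * w.1 ≤ |(g j).2.1| * |w.2| := by
      rw [abs_of_neg hj]; linarith
    calc w.1 ≤ |(g j).2.1| / |(g j).1| * |w.2| := by
          rw [div_mul_eq_mul_div, le_div_iff₀ hα]; linarith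
      _ ≤ _ := mul_le_mul_of_nonneg_right (le_max_left _ _) (abs_nonneg _)
  · rw [abs_of_neg hu]
    have h3 : (g j').1 * (-w.1) ≤ |(g j').2.1| * |w.2| := by linarith
    calc -w.1 ≤ |(g j').2.1| / (g j').1 * |w.2| := by
          rw [div_mul_eq_mul_div, le_div_iff₀ hj']; linarith
      _ ≤ _ := mul_le_mul_of_nonneg_right (le_max_right _ _) (abs_nonneg _)

/-- **Edge case: a band along `λ = 0` inside the polygon.** If the ray `σ · (1, 0)` lies in the
closed active cone and the polygon has a point off the line `λ = 0`, then a product band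
`(a, b) × J` (`J = (0, η)` or `(-η, 0)`, `0 ∉ [a, b]`) near the origin lies in the polygon. -/
theorem exists_band_subset (h0 : ∀ j, 0 ≤ aff (g j) 0) {σ : ℝ} (hσ : σ = 1 ∨ σ = -1)
    (hray : ∀ j, aff (g j) 0 = 0 → 0 ≤ σ * (g j).1) (c₀ : ℝ × ℝ) (hc₀ : c₀ ∈ Om g)
    (hc₀2 : c₀.2 ≠ 0) {ρ₀ : ℝ} (hρ₀ : 0 < ρ₀) :
    ∃ a b η : ℝ, ∃ J' : Set ℝ, a < b ∧ 0 < η ∧ (J' = Ioo 0 η ∨ J' = Ioo (-η) 0) ∧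
      (0 < a ∨ b < 0) ∧ Ioo a b ×ˢ J' ⊆ Om g ∧
      ∀ w ∈ Ioo a b ×ˢ J', |w.1| < ρ₀ ∧ |w.2| < ρ₀ := by
  obtain ⟨ρ, hρ, hcone⟩ := exists_nhds_cone g h0
  have hσ2 : σ * σ = 1 := by rcases hσ with rfl | rfl <;> norm_num
  set τ : ℝ := if 0 < c₀.2 then 1 else -1 with hτ
  have hτ1 : τ = 1 ∨ τ = -1 := by rw [hτ]; split_ifs <;> simp
  have hτ2 : τ * τ = 1 := by rcases hτ1 with h | h <;> rw [h] <;> norm_num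
  have hτc : τ * c₀.2 = |c₀.2| := by
    rw [hτ]; split_ifs with h
    · rw [one_mul, abs_of_pos h]
    · rw [abs_of_neg (lt_of_le_of_ne (not_lt.1 h) hc₀2)]; ring
  have hc2 : 0 < |c₀.2| := abs_pos.2 hc₀2
  set ρ' := min ρ ρ₀ with hρ'
  have hρ'pos : 0 < ρ' := lt_min hρ hρ₀
  set ρ₁ := ρ' / 4 with hρ₁
  set ρ₂ := ρ' / 2 with hρ₂
  set η := min (ρ' / 2) (ρ₁ * |c₀.2| / (|c₀.1| + 1)) with hη
  have hηpos : 0 < η := by positivity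
  have hη1 : η ≤ ρ' / 2 := min_le_left _ _
  have hη2 : η * |c₀.1| ≤ ρ₁ * |c₀.2| := by
    have h1 : η ≤ ρ₁ * |c₀.2| / (|c₀.1| + 1) := min_le_right _ _
    rw [le_div_iff₀ (by positivity)] at h1
    nlinarith [abs_nonneg c₀.1]
  -- the key membership
  have key : ∀ w : ℝ × ℝ, σ * w.1 ∈ Ioo ρ₁ ρ₂ → τ * w.2 ∈ Ioo 0 η → w ∈ Om g ∧
      |w.1| < ρ₀ ∧ |w.2| < ρ₀ := by
    intro w hw1 hw2
    have ha1 : |w.1| = σ * w.1 := by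
      rcases hσ with rfl | rfl
      · rw [one_mul] at hw1 ⊢; exact abs_of_pos (by linarith [hw1.1])
      · rw [neg_one_mul] at hw1 ⊢; exact abs_of_neg (by linarith [hw1.1])
    have ha2 : |w.2| = τ * w.2 := by
      rcases hτ1 with h | h <;> rw [h] at hw2 ⊢
      · rw [one_mul] at hw2 ⊢; exact abs_of_pos hw2.1
      · rw [neg_one_mul] at hw2 ⊢; exact abs_of_neg (by linarith [hw2.1])
    have hb1 : |w.1| < ρ' := by rw [ha1]; linarith [hw1.2]
    have hb2 : |w.2| < ρ' := by rw [ha2]; linarith [hw2.2]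
    refine ⟨hcone w (hb1.trans_le (min_le_left _ _)) (hb2.trans_le (min_le_left _ _))
      fun j hj => ?_, hb1.trans_le (min_le_right _ _), hb2.trans_le (min_le_right _ _)⟩
    have hγ : (g j).2.2 = 0 := by simpa using hj
    have hcj := hc₀ j
    simp only [aff, hγ, add_zero] at hcj ⊢
    set t := τ * w.2 / |c₀.2| with ht
    have htpos : 0 < t := div_pos hw2.1 hc2
    have hτ0 : τ ≠ 0 := by rcases hτ1 with h | h <;> rw [h] <;> norm_num
    have hw2' : w.2 = t * c₀.2 := by
      rw [ht, ← hτc]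
      field_simp
    have hsplit : (g j).1 * w.1 + (g j).2.1 * w.2 =
        (σ * (g j).1) * (σ * w.1 - t * (σ * c₀.1)) + t * ((g j).1 * c₀.1 + (g j).2.1 * c₀.2) := by
      rw [hw2']; linear_combination ((g j).1 * t * c₀.1 - (g j).1 * w.1) * hσ2
    rw [hsplit]
    have h3 : 0 ≤ σ * w.1 - t * (σ * c₀.1) := by
      have h4 : t * (σ * c₀.1) ≤ t * |c₀.1| := by
        refine mul_le_mul_of_nonneg_left ?_ htpos.le
        rcases hσ with rfl | rfl
        · simpa using le_abs_self c₀.1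
        · simpa using neg_le_abs c₀.1
      have h5 : t * |c₀.1| ≤ ρ₁ := by
        rw [ht, div_mul_eq_mul_div, div_le_iff₀ hc2]
        nlinarith [hw2.2, abs_nonneg c₀.1]
      linarith [hw1.1]
    nlinarith [hray j hj, mul_nonneg (hray j hj) h3]
  -- packaging
  have hρ12 : ρ₁ < ρ₂ := by rw [hρ₁, hρ₂]; linarith
  have hρ1pos : 0 < ρ₁ := by positivity
  refine ⟨if σ = 1 then ρ₁ else -ρ₂, if σ = 1 then ρ₂ else -ρ₁, η,
    if τ = 1 then Ioo 0 η else Ioo (-η) 0, ?_, hηpos, ?_, ?_, ?_, ?_⟩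
  · split_ifs <;> linarith
  · split_ifs <;> simp
  · split_ifs
    · exact Or.inl hρ1pos
    · exact Or.inr (by linarith)
  · rintro w ⟨hw1, hw2⟩
    refine (key w ?_ ?_).1
    · rcases hσ with rfl | rfl
      · simpa using hw1
      · simp only [neg_one_mul]
        rw [if_neg (by norm_num), if_neg (by norm_num)] at hw1
        exact ⟨by linarith [hw1.2], by linarith [hw1.1]⟩
    · rcases hτ1 with h | h <;> rw [h] at hw2 ⊢
      · simpa using hw2
      · rw [if_neg (by norm_num)] at hw2
        simp only [neg_one_mul]
        exact ⟨by linarith [hw2.2], by linarith [hw2.1]⟩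
  · rintro w ⟨hw1, hw2⟩
    refine (key w ?_ ?_).2
    · rcases hσ with rfl | rfl
      · simpa using hw1
      · simp only [neg_one_mul]
        rw [if_neg (by norm_num), if_neg (by norm_num)] at hw1
        exact ⟨by linarith [hw1.2], by linarith [hw1.1]⟩
    · rcases hτ1 with h | h <;> rw [h] at hw2 ⊢
      · simpa using hw2
      · rw [if_neg (by norm_num)] at hw2
        simp only [neg_one_mul]
        exact ⟨by linarith [hw2.2], by linarith [hw2.1]⟩

/-- A nonempty open polygon has a point off the `λ`-axis. -/
theorem exists_mem_fst_ne_zero (hne : (Om g).Nonempty) : ∃ c ∈ Om g, c.1 ≠ 0 := by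
  obtain ⟨c₀, hc₀⟩ := hne
  by_cases h : c₀.1 = 0
  · obtain ⟨ε, hε, hball⟩ := Metric.isOpen_iff.1 (isOpen_Om g) c₀ hc₀
    refine ⟨(c₀.1 + ε / 2, c₀.2), hball ?_, by rw [h]; positivity⟩
    rw [Metric.mem_ball, Prod.dist_eq, Real.dist_eq, Real.dist_eq]
    simp only [add_sub_cancel_left, sub_self, abs_zero]
    rw [max_eq_left (abs_nonneg _), abs_of_pos (by positivity)]
    linarith
  · exact ⟨c₀, hc₀, h⟩

/-- **A good sector at the origin inside the polygon.** -/
theorem exists_sector_subset (h0 : ∀ j, 0 ≤ aff (g j) 0) (hne : (Om g).Nonempty) {ρ₀ : ℝ}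
    (hρ₀ : 0 < ρ₀) :
    ∃ σ m₁ m₂ δ : ℝ, (σ = 1 ∨ σ = -1) ∧ m₁ < m₂ ∧ 0 < δ ∧
      ∀ w : ℝ × ℝ, σ * w.1 ∈ Ioo 0 δ → w.2 / w.1 ∈ Ioo m₁ m₂ →
        w ∈ Om g ∧ |w.1| < ρ₀ ∧ |w.2| < ρ₀ := by
  obtain ⟨c, hc, hc1⟩ := exists_mem_fst_ne_zero g hne
  obtain ⟨ρ, hρ, hcone⟩ := exists_nhds_cone g h0
  set σ : ℝ := if 0 < c.1 then 1 else -1 with hσ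
  have hσ1 : σ = 1 ∨ σ = -1 := by rw [hσ]; split_ifs <;> simp
  have hσ2 : σ * σ = 1 := by rcases hσ1 with h | h <;> rw [h] <;> norm_num
  have hσc : σ * c.1 = |c.1| := by
    rw [hσ]; split_ifs with h
    · rw [one_mul, abs_of_pos h]
    · rw [abs_of_neg (lt_of_le_of_ne (not_lt.1 h) hc1)]; ring
  have hca : 0 < |c.1| := abs_pos.2 hc1
  set ms := c.2 / c.1 with hms
  -- the active constraints are strictly positive in the direction `(σ, σ ms)`
  have hdir : ∀ j, aff (g j) 0 = 0 → 0 < σ * ((g j).1 + (g j).2.1 * ms) := by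
    intro j hj
    have hγ : (g j).2.2 = 0 := by simpa using hj
    have h1 := hc j
    simp only [aff, hγ, add_zero] at h1
    have h2 : (g j).1 * c.1 + (g j).2.1 * c.2 = |c.1| * (σ * ((g j).1 + (g j).2.1 * ms)) := by
      rw [← hσc, show σ * c.1 * (σ * ((g j).1 + (g j).2.1 * ms)) =
        (σ * σ) * (c.1 * (g j).1 + (g j).2.1 * (c.1 * ms)) by ring, hσ2, one_mul, hms,
        mul_div_cancel₀ _ hc1]
      ring
    rw [h2] at h1
    exact pos_of_mul_pos_right h1 hca.le
  have hev : ∀ᶠ m in 𝓝 ms, ∀ j, aff (g j) 0 = 0 → 0 < σ * ((g j).1 + (g j).2.1 * m) := by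
    refine eventually_all.2 fun j => ?_
    by_cases hj : aff (g j) 0 = 0
    · have hcont : Continuous fun m : ℝ => σ * ((g j).1 + (g j).2.1 * m) := by fun_prop
      exact ((hcont.tendsto ms).eventually_const_lt (hdir j hj)).mono fun m hm _ => hm
    · exact Eventually.of_forall fun m h => absurd h hj
  obtain ⟨ε, hε, hεb⟩ := Metric.eventually_nhds_iff.1 hev
  set Mb := |ms| + ε + 1 with hMb
  have hMb1 : 1 ≤ Mb := by rw [hMb]; linarith [abs_nonneg ms]
  set δ := min ρ ρ₀ / Mb with hδ
  have hδpos : 0 < δ := by positivity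
  have hδle : δ * Mb = min ρ ρ₀ := by rw [hδ]; field_simp
  refine ⟨σ, ms - ε / 2, ms + ε / 2, δ, hσ1, by linarith, hδpos, fun w hw1 hw2 => ?_⟩
  have hw0 : w.1 ≠ 0 := by
    intro h; rw [h, mul_zero] at hw1; exact lt_irrefl _ hw1.1
  obtain ⟨m, hm⟩ : ∃ m : ℝ, m = w.2 / w.1 := ⟨_, rfl⟩
  rw [← hm] at hw2
  have hwm : w.2 = m * w.1 := by rw [hm]; field_simp
  have hmd : dist m ms < ε := by
    rw [Real.dist_eq, abs_lt]; constructor <;> linarith [hw2.1, hw2.2]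
  have hmb : |m| < |ms| + ε := by
    have := abs_sub_abs_le_abs_sub m ms
    rw [← Real.dist_eq] at this
    linarith
  have hu : |w.1| = σ * w.1 := by
    rcases hσ1 with h | h <;> rw [h] at hw1 ⊢
    · rw [one_mul] at hw1 ⊢; exact abs_of_pos hw1.1
    · rw [neg_one_mul] at hw1 ⊢; exact abs_of_neg (by linarith [hw1.1])
  have hu1 : |w.1| < δ := by rw [hu]; exact hw1.2
  have hb1 : |w.1| < min ρ ρ₀ := by
    calc |w.1| < δ := hu1
      _ ≤ δ * Mb := le_mul_of_one_le_right hδpos.le hMb1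
      _ = min ρ ρ₀ := hδle
  have hb2 : |w.2| < min ρ ρ₀ := by
    rw [hwm, abs_mul]
    calc |m| * |w.1| ≤ Mb * |w.1| := by
          refine mul_le_mul_of_nonneg_right ?_ (abs_nonneg _)
          rw [hMb]; linarith
      _ < Mb * δ := mul_lt_mul_of_pos_left hu1 (by positivity)
      _ = min ρ ρ₀ := by rw [mul_comm, hδle]
  refine ⟨hcone w (hb1.trans_le (min_le_left _ _)) (hb2.trans_le (min_le_left _ _))
    fun j hj => ?_, hb1.trans_le (min_le_right _ _), hb2.trans_le (min_le_right _ _)⟩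
  have hγ : (g j).2.2 = 0 := by simpa using hj
  simp only [aff, hγ, add_zero, hwm]
  have key : (g j).1 * w.1 + (g j).2.1 * (m * w.1) =
      (σ * w.1) * (σ * ((g j).1 + (g j).2.1 * m)) := by
    rw [show (σ * w.1) * (σ * ((g j).1 + (g j).2.1 * m)) =
      (σ * σ) * (w.1 * ((g j).1 + (g j).2.1 * m)) by ring, hσ2, one_mul]
    ring
  rw [key]
  exact mul_pos hw1.1 (hεb hmd j hj)

end SepTwoZero

open SepTwoZero in
/-- **Transversal pole line** (registered sub-goal of `stub_separateTwoZero`): if two constraints active at the origin have `u`-coefficients of opposite signs, then `|u| ≤ C |λ|` on the polygon. -/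
theorem separateTwoZero_cone (J : ℕ) (g : Fin J → ℝ × ℝ × ℝ) (j j' : Fin J) (hj0 : (g j).2.2 = 0) (hj : (g j).1 < 0) (hj'0 : (g j').2.2 = 0) (hj' : 0 < (g j').1) : ∃ C : ℝ, 0 ≤ C ∧ ∀ w : ℝ × ℝ, (∀ l, 0 < (g l).1 * w.1 + (g l).2.1 * w.2 + (g l).2.2) → |w.1| ≤ C * |w.2| := by
  obtain ⟨C, hC, h⟩ := abs_fst_le g j j' (by simpa using hj0) hj (by simpa using hj'0) hj'
  exact ⟨C, hC, fun w hw => h w hw⟩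

end Summit.KontsevichZagierPeriods.ArrangementNormalForm.JanusBands
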